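import Summits.ValiantsHypothesis.ValiantsHypothesis.Theorems.NewtonUnitEquationsTwoProductsPermutationTypeLifted

/-!
# Route NewtonUnitEquations — crux `TwoProducts` (stmt-ValiantsHypothesis-5906): the PERMUTATION-TYPE LAW, part R3c —
# the push-forward `Y_i ↦ X^{E i}`, `B_h`-injectivity on low degrees, and the planar instance (`minUnequal_of_visible`)

Parts (D2)/(D3) of the ideator's `Lifted` toolkit: the letter substitution `phi E : Y_i ↦ X^{E i}` with exponent map `piE`, its
coefficient formula and support (`coeff_phi`, `coeff_phi_of_injOn`, `phi_lin`), degree-`≤ h` injectivity `InjDeg` from the strong `B_h`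
property (`injDeg_of_isBm`), degrees of the lifted support (`deg_le_of_mem_support_liftG`); the planar instance of
`…FormalLogLinearisationDefs` / `…PlanarCrossCount` (tails `u v : Fin m → ℂ[x,y]`, alphabet `tailSupport u v` enumerated by `enum`,
coefficient tables `cU`/`cV`) as a push-forward of the lifted one (`phi_lin_cU`, `phi_liftG : phi (liftG cU cV) = tailDiff u v`,
`injOn_support_liftG`), and **`minUnequal_of_visible`**: if the push-forward is injective on the lifted support, a planar visible point
(strict `ξ`-top) lifts to the strict minimal unequal moment.  Over R3b (`…PermutationTypeLifted`). [folklore]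

PORT NOTE.  Theorems-side port (val-lit port pool, seat val-port-2; crit-3 RE-READ #15/#17: R3/R3♯ PASS by name; director-valiant
g12-R137 (b)) of the ideator's turnkey v3 `turnkey/NewtonUnitEquationsTwoProductsPermutationTypeLaw.lean` sha16 b74751413dcd7320
(1410 l.) = tree `Cruxes/TwoProducts/Lines/relation_ladder_turnkey_PermutationTypeLaw.lean` @237e39b34ac9, split by the 400-line
rule into FIVE files, texts VERBATIM, cut at the author's part boundaries: (R3a) `…PermutationTypeWeightOrder.lean` = Parts A/B
(p611005; v3 l.46–346 = v1 verbatim); (R3b) `…PermutationTypeLifted.lean` = Parts B-end/C/D1 (p611551; v3 l.347–596 = v1 verbatim);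
(R3c) `…PermutationTypePushForward.lean` = Parts D2/D3 (v3 l.599–909: `phi`, `piE`, `InjDeg`, the planar instance,
`minUnequal_of_visible` in its v2/v3 `Set.InjOn` form); (R3d) `…PermutationTypeCount.lean` = Part D4 + Count (v3 l.912–1125:
`pencil_param`, `count_of_injOn`, `permutationTypeLaw_proof`); (R3e) `…PermutationTypeLaw.lean` = Part G + R5 + statements (v3
l.1127–1406: `PermType`, `msetT`, `IsBm`, `visibleCount_of_isBm`, `visibleCount_of_permType`, `visibleCount_of_mergedPermType`,
`visibleCount_of_confined_blockSmall`).  Helper mode (`--supports stmt-ValiantsHypothesis-5906 --as helper`); nothing here closes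
the line's residual `ResidualLawV10`, `PlanarCellBound`, the crux `TwoProducts` or `VP ≠ VNP`; no summit statement is proved.
-/

noncomputable section

-- Sub = Summit single-conjunct layout: the duplicated namespace component is mandated by the tree.
set_option linter.dupNamespace false

namespace Summit.ValiantsHypothesis.ValiantsHypothesis.Theorems.NewtonUnitEquations.TwoProducts.PermutationType
open scoped BigOperators
open MvPolynomial

variable {σ : Type*} [Fintype σ] [DecidableEq σ]

/-! ## Part D2: push-forward `Y_i ↦ X^{E i}` to the plane, its coefficient formula, injectivity and degrees -/

section PushForward
variable (E : σ → (Fin 2 →₀ ℕ))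

/-- The letter substitution `Y_i ↦ X^{E i}`. [folklore] -/
def phi : MvPolynomial σ ℂ →ₐ[ℂ] MvPolynomial (Fin 2) ℂ :=
  aeval fun i => (monomial (E i) (1 : ℂ) : MvPolynomial (Fin 2) ℂ)

/-- The induced map on exponents `κ ↦ Σ κ_i • E i`. [folklore] -/
def piE (κ : σ →₀ ℕ) : Fin 2 →₀ ℕ := κ.sum fun i k => k • E i

omit [DecidableEq σ] in
/-- `piE_eq_sum` (R3 toolkit). [folklore] -/
theorem piE_eq_sum (κ : σ →₀ ℕ) : piE E κ = ∑ i, κ i • E i := by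
  unfold piE; exact Finsupp.sum_fintype _ _ (fun _ => by simp)

omit [Fintype σ] [DecidableEq σ] in
/-- `phi_monomial` (R3 toolkit). [folklore] -/
theorem phi_monomial (κ : σ →₀ ℕ) (a : ℂ) : phi E (monomial κ a) = monomial (piE E κ) a := by
  unfold phi piE
  rw [aeval_monomial, monomial_finsupp_sum_index]
  rw [MvPolynomial.algebraMap_eq]
  congr 1
  refine Finsupp.prod_congr fun i _ => ?_
  rw [monomial_pow, one_pow]

omit [Fintype σ] [DecidableEq σ] in
/-- `phi_eq_sum` (R3 toolkit). [folklore] -/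
theorem phi_eq_sum (H : MvPolynomial σ ℂ) : phi E H = ∑ κ ∈ H.support, monomial (piE E κ) (coeff κ H) := by
  conv_lhs => rw [as_sum H]
  rw [map_sum]
  exact Finset.sum_congr rfl fun κ _ => phi_monomial E κ _

omit [Fintype σ] [DecidableEq σ] in
/-- `coeff_phi` (R3 toolkit). [folklore] -/
theorem coeff_phi (H : MvPolynomial σ ℂ) (n : Fin 2 →₀ ℕ) :
    coeff n (phi E H) = ∑ κ ∈ H.support with piE E κ = n, coeff κ H := by
  classical
  rw [phi_eq_sum, coeff_sum, Finset.sum_filter]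
  refine Finset.sum_congr rfl fun κ _ => ?_
  rw [coeff_monomial]

omit [Fintype σ] [DecidableEq σ] in
/-- `exists_of_mem_support_phi` (R3 toolkit). [folklore] -/
theorem exists_of_mem_support_phi (H : MvPolynomial σ ℂ) (n : Fin 2 →₀ ℕ) (hn : n ∈ (phi E H).support) :
    ∃ κ ∈ H.support, piE E κ = n := by
  classical
  rw [mem_support_iff, coeff_phi] at hn
  obtain ⟨κ, hκ, -⟩ := Finset.exists_ne_zero_of_sum_ne_zero hn
  exact ⟨κ, (Finset.mem_filter.mp hκ).1, (Finset.mem_filter.mp hκ).2⟩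

omit [Fintype σ] [DecidableEq σ] in
/-- `coeff_phi_of_injOn` (R3 toolkit). [folklore] -/
theorem coeff_phi_of_injOn (H : MvPolynomial σ ℂ) (hinj : Set.InjOn (piE E) ↑H.support) (κ : σ →₀ ℕ)
    (hκ : κ ∈ H.support) : coeff (piE E κ) (phi E H) = coeff κ H := by
  classical
  rw [coeff_phi]
  have hfil : (H.support.filter fun κ' => piE E κ' = piE E κ) = {κ} := by
    ext κ'
    simp only [Finset.mem_filter, Finset.mem_singleton]
    constructor
    · rintro ⟨h1, h2⟩; exact hinj h1 hκ h2
    · rintro rfl; exact ⟨hκ, rfl⟩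
  rw [hfil, Finset.sum_singleton]

omit [DecidableEq σ] in
/-- `phi_lin` (R3 toolkit). [folklore] -/
theorem phi_lin (a : σ → ℂ) : phi E (lin a) = ∑ i, monomial (E i) (a i) := by
  unfold lin
  rw [map_sum]
  refine Finset.sum_congr rfl fun i _ => ?_
  rw [map_smul, show (X i : MvPolynomial σ ℂ) = monomial (Finsupp.single i 1) 1 from rfl, phi_monomial]
  rw [piE, Finsupp.sum_single_index (by simp), one_smul, smul_monomial, smul_eq_mul, mul_one]

/-- Injectivity on exponents of degree `≤ h` (the lifted form of the `B_h` property). [folklore] -/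
def InjDeg (h : ℕ) : Prop :=
  ∀ κ κ' : σ →₀ ℕ, deg κ ≤ h → deg κ' ≤ h → piE E κ = piE E κ' → κ = κ'

omit [Fintype σ] [DecidableEq σ] in
/-- `InjDeg` from the `B_h` property of the alphabet `T ⊇ range E`, `E` injective. [folklore] -/
theorem injDeg_of_isBm (h : ℕ) (T : Finset (Fin 2 →₀ ℕ)) (hE : Function.Injective E) (hET : ∀ i, E i ∈ T)
    (hBm : ∀ ν ν' : (Fin 2 →₀ ℕ) →₀ ℕ, ν.support ⊆ T → ν'.support ⊆ T →
      (ν.sum fun _ k => k) ≤ h → (ν'.sum fun _ k => k) ≤ h →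
      (ν.sum fun e k => k • e) = (ν'.sum fun e k => k • e) → ν = ν') :
    InjDeg E h := by
  classical
  intro κ κ' hκ hκ' hπ
  have hsupp : ∀ κ : σ →₀ ℕ, (Finsupp.mapDomain E κ).support ⊆ T := fun κ => by
    intro e he
    obtain ⟨i, -, rfl⟩ := Finset.mem_image.mp (Finsupp.mapDomain_support he)
    exact hET i
  have hdeg : ∀ κ : σ →₀ ℕ, ((Finsupp.mapDomain E κ).sum fun _ k => k) = deg κ := fun κ => by
    unfold deg
    exact Finsupp.sum_mapDomain_index (fun _ => rfl) (fun _ _ _ => rfl)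
  have hsum : ∀ κ : σ →₀ ℕ, ((Finsupp.mapDomain E κ).sum fun e k => k • e) = piE E κ := fun κ => by
    unfold piE
    exact Finsupp.sum_mapDomain_index (fun _ => zero_smul _ _) (fun _ _ _ => add_smul _ _ _)
  have := hBm (Finsupp.mapDomain E κ) (Finsupp.mapDomain E κ') (hsupp κ) (hsupp κ')
    (by rw [hdeg]; exact hκ) (by rw [hdeg]; exact hκ') (by rw [hsum, hsum]; exact hπ)
  exact Finsupp.mapDomain_injective hE this

end PushForward

omit [DecidableEq σ] in
/-- Degree bound: exponents of the lifted difference have degree `≤ m`. [folklore] -/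
theorem deg_le_of_mem_support_liftG {m : ℕ} (c d : Fin m → σ → ℂ) (κ : σ →₀ ℕ)
    (hκ : κ ∈ (liftG c d).support) : deg κ ≤ m := by
  have hlin : ∀ a : σ → ℂ, (1 + lin a).totalDegree ≤ 1 := fun a => by
    refine (totalDegree_add _ _).trans (max_le (by simp) ?_)
    unfold lin
    refine totalDegree_finsetSum_le fun i _ => ?_
    refine (totalDegree_smul_le _ _).trans ?_
    nontriviality ℂ
    rw [totalDegree_X]
  have hprod : ∀ a : Fin m → σ → ℂ, (∏ j, (1 + lin (a j))).totalDegree ≤ m := fun a => by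
    refine (totalDegree_finsetProd _ _).trans ?_
    calc ∑ j, (1 + lin (a j)).totalDegree ≤ ∑ _j : Fin m, 1 := Finset.sum_le_sum fun j _ => hlin (a j)
      _ = m := by simp
  have hG : (liftG c d).totalDegree ≤ m := by
    unfold liftG
    exact (totalDegree_sub _ _).trans (max_le (hprod c) (hprod d))
  exact (le_totalDegree hκ).trans hG


/-! ## Part D3: the planar instance as a push-forward of the lifted one; visible points are lifted strict minima -/

section Planar
open Summit.ValiantsHypothesis.ValiantsHypothesis.Theorems.NewtonUnitEquations.TwoProducts.FormalLogLinearisation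
open Summit.ValiantsHypothesis.ValiantsHypothesis.Theorems.NewtonUnitEquations.TwoProducts.PlanarCell

/-- `wt_piE` (R3 toolkit). [folklore] -/
theorem wt_piE {s : ℕ} (ξ : Fin 2 → ℝ) (E : Fin s → Expo) (κ : Fin s →₀ ℕ) :
    wt ξ (piE E κ) = ∑ i, (κ i : ℝ) * wt ξ (E i) := by
  rw [piE_eq_sum, wt_sum]
  exact Finset.sum_congr rfl fun i _ => wt_nsmul ξ (κ i) (E i)

/-- `lwt_eq_neg_wt` (R3 toolkit). [folklore] -/
theorem lwt_eq_neg_wt {s : ℕ} (ξ : Fin 2 → ℝ) (E : Fin s → Expo) (κ : Fin s →₀ ℕ) :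
    lwt (fun i => -wt ξ (E i)) κ = -wt ξ (piE E κ) := by
  unfold lwt
  rw [wt_piE, ← Finset.sum_neg_distrib]
  exact Finset.sum_congr rfl fun i _ => by ring

variable {m : ℕ} (u v : Fin m → MvPolynomial (Fin 2) ℂ)

/-- Number of tail letters. [folklore] -/
def sE : ℕ := (tailSupport u v).card

/-- Enumeration of the tail alphabet. [folklore] -/
def enum (i : Fin (sE u v)) : Expo := (((tailSupport u v).equivFin.symm i : ↥(tailSupport u v)) : Expo)

/-- `enum_mem` (R3 toolkit). [folklore] -/
theorem enum_mem (i : Fin (sE u v)) : enum u v i ∈ tailSupport u v :=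
  ((tailSupport u v).equivFin.symm i).2

/-- `enum_injective` (R3 toolkit). [folklore] -/
theorem enum_injective : Function.Injective (enum u v) := by
  intro i j h
  have : (tailSupport u v).equivFin.symm i = (tailSupport u v).equivFin.symm j := Subtype.ext h
  exact (tailSupport u v).equivFin.symm.injective this

/-- `sum_enum` (R3 toolkit). [folklore] -/
theorem sum_enum {M : Type*} [AddCommMonoid M] (f : Expo → M) :
    ∑ i, f (enum u v i) = ∑ e ∈ tailSupport u v, f e := by
  rw [← Finset.sum_coe_sort (tailSupport u v) f]
  exact Equiv.sum_comp (tailSupport u v).equivFin.symm (fun x : ↥(tailSupport u v) => f (x : Expo))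

/-- Lifted coefficient matrices. [folklore] -/
def cU (j : Fin m) (i : Fin (sE u v)) : ℂ := coeff (enum u v i) (u j)
/-- `cV` (R3 toolkit). [folklore] -/
def cV (j : Fin m) (i : Fin (sE u v)) : ℂ := coeff (enum u v i) (v j)

/-- `support_u_subset` (R3 toolkit). [folklore] -/
theorem support_u_subset (j : Fin m) : (u j).support ⊆ tailSupport u v := by
  intro e he; unfold tailSupport
  exact Finset.mem_union_left _ (Finset.mem_biUnion.mpr ⟨j, Finset.mem_univ _, he⟩)

/-- `support_v_subset` (R3 toolkit). [folklore] -/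
theorem support_v_subset (j : Fin m) : (v j).support ⊆ tailSupport u v := by
  intro e he; unfold tailSupport
  exact Finset.mem_union_right _ (Finset.mem_biUnion.mpr ⟨j, Finset.mem_univ _, he⟩)

/-- `eq_sum_monomial_of_subset` (R3 toolkit). [folklore] -/
theorem eq_sum_monomial_of_subset (p : MvPolynomial (Fin 2) ℂ) (T : Finset Expo) (hT : p.support ⊆ T) :
    p = ∑ e ∈ T, monomial e (coeff e p) := by
  conv_lhs => rw [as_sum p]
  refine Finset.sum_subset hT fun e _ he => ?_
  rw [notMem_support_iff.mp he, monomial_zero]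

/-- `phi_lin_cU` (R3 toolkit). [folklore] -/
theorem phi_lin_cU (j : Fin m) : phi (enum u v) (lin (cU u v j)) = u j := by
  rw [phi_lin]
  unfold cU
  rw [sum_enum u v (fun e => monomial e (coeff e (u j)))]
  exact (eq_sum_monomial_of_subset (u j) _ (support_u_subset u v j)).symm

/-- `phi_lin_cV` (R3 toolkit). [folklore] -/
theorem phi_lin_cV (j : Fin m) : phi (enum u v) (lin (cV u v j)) = v j := by
  rw [phi_lin]
  unfold cV
  rw [sum_enum u v (fun e => monomial e (coeff e (v j)))]
  exact (eq_sum_monomial_of_subset (v j) _ (support_v_subset u v j)).symm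

/-- `phi_liftG` (R3 toolkit). [folklore] -/
theorem phi_liftG : phi (enum u v) (liftG (cU u v) (cV u v)) = tailDiff u v := by
  unfold liftG tailDiff
  rw [map_sub, map_prod, map_prod]
  simp only [map_add, map_one, phi_lin_cU, phi_lin_cV]

/-- Letters are nonzero exponents (tails are constant-free). [folklore] -/
theorem enum_ne_zero (hu : ∀ j, coeff 0 (u j) = 0) (hv : ∀ j, coeff 0 (v j) = 0) (i : Fin (sE u v)) :
    enum u v i ≠ 0 := by
  intro h0
  have hmem := enum_mem u v i
  rw [h0] at hmem
  unfold tailSupport at hmem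
  rcases Finset.mem_union.mp hmem with h | h
  · obtain ⟨j, -, hj⟩ := Finset.mem_biUnion.mp h
    exact (mem_support_iff.mp hj) (hu j)
  · obtain ⟨j, -, hj⟩ := Finset.mem_biUnion.mp h
    exact (mem_support_iff.mp hj) (hv j)

/-- Valid weights are negative on letters. [folklore] -/
theorem wt_enum_neg (ξ : Fin 2 → ℝ) (hval : ValidWeight u v ξ) (i : Fin (sE u v)) : wt ξ (enum u v i) < 0 := by
  have hmem := enum_mem u v i
  unfold tailSupport at hmem
  rcases Finset.mem_union.mp hmem with h | h
  · obtain ⟨j, -, hj⟩ := Finset.mem_biUnion.mp h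
    exact hval.1 j _ hj
  · obtain ⟨j, -, hj⟩ := Finset.mem_biUnion.mp h
    exact hval.2 j _ hj

/-- `IsBm` (route-file form) ⇒ injectivity of `piE enum` in degree `≤ m`. [folklore] -/
theorem injDeg_enum (hBm : ∀ ν ν' : Expo →₀ ℕ, ν.support ⊆ tailSupport u v → ν'.support ⊆ tailSupport u v →
      (ν.sum fun _ k => k) ≤ m → (ν'.sum fun _ k => k) ≤ m →
      (ν.sum fun e k => k • e) = (ν'.sum fun e k => k • e) → ν = ν') :
    InjDeg (enum u v) m :=
  injDeg_of_isBm (enum u v) m (tailSupport u v) (enum_injective u v) (enum_mem u v) hBm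

/-- `injOn_support_liftG` (R3 toolkit). [folklore] -/
theorem injOn_support_liftG (hBm : InjDeg (enum u v) m) :
    Set.InjOn (piE (enum u v)) ↑(liftG (cU u v) (cV u v)).support := by
  intro κ hκ κ' hκ' h
  exact hBm κ κ' (deg_le_of_mem_support_liftG _ _ κ hκ) (deg_le_of_mem_support_liftG _ _ κ' hκ') h

/-- A planar visible point lifts to a strict `ξ`-extremum of the lifted support. [folklore] -/
theorem lifted_of_visible (hinj : Set.InjOn (piE (enum u v)) ↑(liftG (cU u v) (cV u v)).support) (ξ : Fin 2 → ℝ)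
    (l : Expo) (htop : IsStrictTop ξ ↑(tailDiff u v).support l) :
    ∃ κ₀ : Fin (sE u v) →₀ ℕ, κ₀ ∈ (liftG (cU u v) (cV u v)).support ∧ piE (enum u v) κ₀ = l ∧
      ∀ κ ∈ (liftG (cU u v) (cV u v)).support, κ ≠ κ₀ → wt ξ (piE (enum u v) κ) < wt ξ l := by
  have hsupp : (tailDiff u v) = phi (enum u v) (liftG (cU u v) (cV u v)) := (phi_liftG u v).symm
  obtain ⟨hl, hlt⟩ := htop
  have hl' : l ∈ (phi (enum u v) (liftG (cU u v) (cV u v))).support := by rw [← hsupp]; exact hl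
  obtain ⟨κ₀, hκ₀, hπ⟩ := exists_of_mem_support_phi (enum u v) _ l hl'
  refine ⟨κ₀, hκ₀, hπ, fun κ hκ hne => ?_⟩
  have hcoeff : coeff (piE (enum u v) κ) (tailDiff u v) ≠ 0 := by
    rw [hsupp, coeff_phi_of_injOn (enum u v) _ hinj κ hκ]
    exact mem_support_iff.mp hκ
  have hneπ : piE (enum u v) κ ≠ l := by
    intro h
    exact hne (hinj hκ hκ₀ (h.trans hπ.symm))
  exact hlt _ (mem_support_iff.mpr hcoeff) hneπ

/-- **Lemma A, planar form.** Under injectivity of the push-forward on the lifted support, a planar visible point `l` (valid `ξ`) lifts to `κ₀` with `piE κ₀ = l` which is an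
UNEQUAL MOMENT and the strict `ξ`-extremal one: every other unequal moment `κ` has `wt ξ (piE κ) < wt ξ l`. [folklore] -/
theorem minUnequal_of_visible (hinj : Set.InjOn (piE (enum u v)) ↑(liftG (cU u v) (cV u v)).support) (ξ : Fin 2 → ℝ)
    (hval : ValidWeight u v ξ) (l : Expo) (htop : IsStrictTop ξ ↑(tailDiff u v).support l) :
    ∃ κ₀ : Fin (sE u v) →₀ ℕ, piE (enum u v) κ₀ = l ∧
      (∑ j, mom (cU u v j) κ₀ ≠ ∑ j, mom (cV u v j) κ₀) ∧
      ∀ κ : Fin (sE u v) →₀ ℕ, κ ≠ κ₀ → (∑ j, mom (cU u v j) κ ≠ ∑ j, mom (cV u v j) κ) →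
        wt ξ (piE (enum u v) κ) < wt ξ (piE (enum u v) κ₀) := by
  obtain ⟨κ₀, hκ₀, hπ, hmin⟩ := lifted_of_visible u v hinj ξ l htop
  -- positive weights θ_i = -wt ξ (E i), rescaled to be ≥ 1
  have hθpos : ∀ i, 0 < -wt ξ (enum u v i) := fun i => by linarith [wt_enum_neg u v ξ hval i]
  -- the index type is nonempty (κ₀ ≠ 0)
  have hκ₀ne : κ₀ ≠ 0 := by
    intro h0
    have := mem_support_iff.mp hκ₀
    apply this
    rw [h0]; unfold liftG
    rw [coeff_sub, coeff_zero_prod_eq_one _ (fun j => coeff_zero_one_add_lin _),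
      coeff_zero_prod_eq_one _ (fun j => coeff_zero_one_add_lin _), sub_self]
  obtain ⟨i₀, -⟩ : ∃ i, κ₀ i ≠ 0 := by
    by_contra h; push Not at h; exact hκ₀ne (Finsupp.ext fun i => by simpa using h i)
  have hne : (Finset.univ : Finset (Fin (sE u v))).Nonempty := ⟨i₀, Finset.mem_univ _⟩
  set θmin : ℝ := Finset.univ.inf' hne (fun i => -wt ξ (enum u v i)) with hθmin
  have hθmin_pos : 0 < θmin := by
    obtain ⟨i, -, hi⟩ := Finset.exists_mem_eq_inf' hne (fun i => -wt ξ (enum u v i))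
    rw [hθmin, hi]; exact hθpos i
  have hθmin_le : ∀ i, θmin ≤ -wt ξ (enum u v i) := fun i => Finset.inf'_le _ (Finset.mem_univ i)
  set θ' : Fin (sE u v) → ℝ := fun i => -wt ξ (enum u v i) / θmin with hθ'
  have hθ'1 : ∀ i, 1 ≤ θ' i := fun i => by
    rw [hθ']; exact (one_le_div hθmin_pos).mpr (hθmin_le i)
  have hlwt' : ∀ κ : Fin (sE u v) →₀ ℕ, lwt θ' κ = (-wt ξ (piE (enum u v) κ)) / θmin := fun κ => by
    rw [← lwt_eq_neg_wt]; unfold lwt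
    rw [Finset.sum_div]
    exact Finset.sum_congr rfl fun i _ => by rw [hθ']; ring
  have hstrict : κ₀ ∈ (liftG (cU u v) (cV u v)).support ∧
      ∀ κ ∈ (liftG (cU u v) (cV u v)).support, κ ≠ κ₀ → lwt θ' κ₀ < lwt θ' κ := by
    refine ⟨hκ₀, fun κ hκ hne => ?_⟩
    rw [hlwt', hlwt', hπ]
    exact div_lt_div_of_pos_right (by linarith [hmin κ hκ hne]) hθmin_pos
  obtain ⟨h1, h2⟩ := lifted_minUnequal θ' hθ'1 (cU u v) (cV u v) κ₀ hstrict
  refine ⟨κ₀, hπ, h1, fun κ hne hneq => ?_⟩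
  have := h2 κ hne hneq
  rw [hlwt', hlwt'] at this
  have := (div_lt_div_iff_of_pos_right hθmin_pos).mp this
  linarith

end Planar

end Summit.ValiantsHypothesis.ValiantsHypothesis.Theorems.NewtonUnitEquations.TwoProducts.PermutationType

end
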